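import Summits.HubbardSuperconductivity.HubbardSuperconductivity.Theorems.AnisotropyChordStiffnessLocalOps
import Summits.HubbardSuperconductivity.HubbardSuperconductivity.Theorems.AnisotropyChordStiffnessBondCounting
import Summits.HubbardSuperconductivity.HubbardSuperconductivity.Theorems.AnisotropyChordStiffnessNearFarPairs

/-!
# Route `AnisotropyChord` / H0 rotor rung: STUB K1′ `DoubleCommutatorBound` PROVED by support counting
# (theory seat memo ROTOR-THEORY-8 §120/§121, work-order W5)

`W = W_k(ε) = Σ_b c_b j_b` (`c_{(x,i)} = εᵢ φ_k(x)`), `H = −Σ_e h_e` (`L ≥ 3`), and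
`[Wᴴ,[H,W]] = −Σ_{b',e,b} conj(c_{b'}) c_b [j_{b'}ᴴ,[h_e,j_b]]`; the bracket `dcOp b' e b` vanishes unless `e` meets `b`
and `b'` meets `e ∪ b` (locality, `commute_of_disjoint`), is bounded by `(1/2 + |Δ|/4)‖ψ‖²` in expectation
(contraction bounds of `AnisotropyChordStiffnessLocalOps`), and the weighted count `norm_triple_sum_le` gives
`Re⟨ψ,[Wᴴ,[H,W]]ψ⟩ ≤ 128(1/2 + |Δ|/4)·L²·Σⱼ|εⱼ|²`.

* `bondOp`, `bondH`, `dcOp`; `dcOp_eq_zero_of_not_rel`; `norm_expect_dcOp_le`;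
* `triple_mul_expand`, `currentComb_eq_sum_bondOp`, `doubleComm_expand`;
* **`doubleCommutatorBound_holds : DoubleCommutatorBound Δ M`** (with `C_J = 128(1/2 + |Δ|/4) + 1`).
-/

set_option linter.dupNamespace false

noncomputable section

open Matrix Complex Finset Filter Topology
open scoped ComplexConjugate
open Literature.MathematicalPhysics.QuantumLattice hiding torusPhase torusNorm
open Literature.Probability.LatticeModels
open Summit.HubbardSuperconductivity.HubbardSuperconductivity.Theorems.AnisotropyChord.InsertionEntropy

namespace Summit.HubbardSuperconductivity.HubbardSuperconductivity.Theorems.AnisotropyChord.Stiffness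

variable {L : ℕ} [NeZero L]

/-! ## Bond-indexed operators and the double-commutator bracket -/

/-- The current of the directed bond `b = (x,i)`: `j_b = j_{x, x+eᵢ}`. -/
def bondOp (L : ℕ) [NeZero L] (b : TorusSite 2 L × Fin 2) : Op (TorusSite 2 L) 2 :=
  bondCurrent L b.1 (b.1 + Pi.single b.2 1)

/-- The XXZ term of the directed bond `e = (x,i)`: `h_e = h_{x, x+eᵢ}`. -/
def bondH (L : ℕ) [NeZero L] (Δ : ℝ) (e : TorusSite 2 L × Fin 2) : Op (TorusSite 2 L) 2 :=
  xxzBond L Δ e.1 (e.1 + Pi.single e.2 1)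

/-- The double-commutator bracket `[j_{b'}ᴴ, [h_e, j_b]]` written out in the association of `DoubleCommutatorBound`. -/
def dcOp (L : ℕ) [NeZero L] (Δ : ℝ) (b' e b : TorusSite 2 L × Fin 2) : Op (TorusSite 2 L) 2 :=
  (bondOp L b')ᴴ * (bondH L Δ e * bondOp L b) - (bondOp L b')ᴴ * (bondOp L b * bondH L Δ e)
    - bondH L Δ e * (bondOp L b * (bondOp L b')ᴴ) + bondOp L b * (bondH L Δ e * (bondOp L b')ᴴ)

/-- `j_b` is supported on the two sites of `b`. -/
theorem isSupportedOn_bondOp (b : TorusSite 2 L × Fin 2) : IsSupportedOn (bondOp L b) (bondSupp L b) :=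
  isSupportedOn_bondCurrent b.1 (b.1 + Pi.single b.2 1)

/-- `j_bᴴ` is supported on the two sites of `b`. -/
theorem isSupportedOn_bondOp_conjTranspose (b : TorusSite 2 L × Fin 2) :
    IsSupportedOn (bondOp L b)ᴴ (bondSupp L b) :=
  (isSupportedOn_bondOp b).star

/-- `h_e` is supported on the two sites of `e`. -/
theorem isSupportedOn_bondH (Δ : ℝ) (e : TorusSite 2 L × Fin 2) : IsSupportedOn (bondH L Δ e) (bondSupp L e) :=
  isSupportedOn_xxzBond Δ e.1 (e.1 + Pi.single e.2 1)

/-- **Locality**: the bracket vanishes unless `e` meets `b` and `b'` meets `e ∪ b`. -/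
theorem dcOp_eq_zero_of_not_rel (Δ : ℝ) {b' e b : TorusSite 2 L × Fin 2} (h : ¬ BondRel L b' e b) :
    dcOp L Δ b' e b = 0 := by
  unfold BondRel at h
  rw [not_and_or, not_not, not_not] at h
  unfold dcOp
  set A := (bondOp L b')ᴴ
  set Hm := bondH L Δ e
  set J := bondOp L b
  rcases h with h | h
  · have hc : Hm * J = J * Hm :=
      (commute_of_disjoint_holds (isSupportedOn_bondH Δ e) (isSupportedOn_bondOp b) h).eq
    rw [hc, ← mul_assoc Hm J A, hc, mul_assoc]
    abel
  · have hA : IsSupportedOn A (bondSupp L b') := isSupportedOn_bondOp_conjTranspose b'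
    have hcH : A * Hm = Hm * A :=
      (commute_of_disjoint_holds hA
        (IsSupportedOn.mono_holds (isSupportedOn_bondH Δ e) Finset.subset_union_left) h).eq
    have hcJ : A * J = J * A :=
      (commute_of_disjoint_holds hA
        (IsSupportedOn.mono_holds (isSupportedOn_bondOp b) Finset.subset_union_right) h).eq
    rw [← mul_assoc A Hm J, hcH, mul_assoc, hcJ, ← mul_assoc A J Hm, hcJ, mul_assoc, hcH]
    abel

/-! ## The bracket is bounded in expectation -/

/-- `|⟨ψ, X(Y(Zψ))⟩| ≤ c_X c_Y c_Z ‖ψ‖²` for `ℓ²`-bounded `X, Y, Z`. -/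
theorem norm_expect_triple_le {X Y Z : Op (TorusSite 2 L) 2} {cX cY cZ : ℝ} (hX0 : 0 ≤ cX) (hY0 : 0 ≤ cY)
    (hX : ∀ v, ‖WithLp.toLp 2 (X *ᵥ v)‖ ≤ cX * ‖WithLp.toLp 2 v‖)
    (hY : ∀ v, ‖WithLp.toLp 2 (Y *ᵥ v)‖ ≤ cY * ‖WithLp.toLp 2 v‖)
    (hZ : ∀ v, ‖WithLp.toLp 2 (Z *ᵥ v)‖ ≤ cZ * ‖WithLp.toLp 2 v‖)
    (ψ : TensorIndex (TorusSite 2 L) 2 → ℂ) :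
    ‖star ψ ⬝ᵥ ((X * (Y * Z)) *ᵥ ψ)‖ ≤ cX * cY * cZ * ‖WithLp.toLp 2 ψ‖ ^ 2 := by
  rw [← Matrix.mulVec_mulVec, ← Matrix.mulVec_mulVec]
  have h1 := norm_star_dotProduct_le ψ (X *ᵥ (Y *ᵥ (Z *ᵥ ψ)))
  have h2 : ‖WithLp.toLp 2 (X *ᵥ (Y *ᵥ (Z *ᵥ ψ)))‖ ≤ cX * (cY * (cZ * ‖WithLp.toLp 2 ψ‖)) :=
    (hX _).trans (mul_le_mul_of_nonneg_left ((hY _).trans (mul_le_mul_of_nonneg_left (hZ _) hY0)) hX0)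
  have h0 : 0 ≤ ‖WithLp.toLp 2 ψ‖ := norm_nonneg _
  calc _ ≤ ‖WithLp.toLp 2 ψ‖ * ‖WithLp.toLp 2 (X *ᵥ (Y *ᵥ (Z *ᵥ ψ)))‖ := h1
    _ ≤ ‖WithLp.toLp 2 ψ‖ * (cX * (cY * (cZ * ‖WithLp.toLp 2 ψ‖))) := mul_le_mul_of_nonneg_left h2 h0
    _ = cX * cY * cZ * ‖WithLp.toLp 2 ψ‖ ^ 2 := by ring

/-- **`|⟨ψ, dcOp ψ⟩| ≤ (1/2 + |Δ|/4)‖ψ‖²`** (`L ≥ 2`). -/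
theorem norm_expect_dcOp_le (hL : 2 ≤ L) (Δ : ℝ) (b' e b : TorusSite 2 L × Fin 2)
    (ψ : TensorIndex (TorusSite 2 L) 2 → ℂ) :
    ‖star ψ ⬝ᵥ (dcOp L Δ b' e b *ᵥ ψ)‖ ≤ (1 / 2 + |Δ| / 4) * ‖WithLp.toLp 2 ψ‖ ^ 2 := by
  set κ : ℝ := 1 / 2 + |Δ| / 4 with hκ
  have hκ0 : 0 ≤ κ := by positivity
  have hJ : ∀ (d : TorusSite 2 L × Fin 2) v, ‖WithLp.toLp 2 (bondOp L d *ᵥ v)‖ ≤ 1 / 2 * ‖WithLp.toLp 2 v‖ :=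
    fun d v => norm_toLp_bondCurrent_mulVec_le _ _ v
  have hne : ∀ d : TorusSite 2 L × Fin 2, d.1 ≠ d.1 + Pi.single d.2 1 :=
    fun d => (add_single_ne_self hL d.1 d.2).symm
  have hA : ∀ (d : TorusSite 2 L × Fin 2) v, ‖WithLp.toLp 2 ((bondOp L d)ᴴ *ᵥ v)‖ ≤ 1 / 2 * ‖WithLp.toLp 2 v‖ := by
    intro d v
    unfold bondOp
    rw [bondCurrent_conjTranspose (hne d), Matrix.neg_mulVec, WithLp.toLp_neg, norm_neg]
    exact norm_toLp_bondCurrent_mulVec_le _ _ v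
  have hH : ∀ (d : TorusSite 2 L × Fin 2) v, ‖WithLp.toLp 2 (bondH L Δ d *ᵥ v)‖ ≤ κ * ‖WithLp.toLp 2 v‖ :=
    fun d v => norm_toLp_xxzBond_mulVec_le Δ (hne d) v
  have h12 : (0 : ℝ) ≤ 1 / 2 := by norm_num
  have t1 := norm_expect_triple_le h12 hκ0 (hA b') (hH e) (hJ b) ψ
  have t2 := norm_expect_triple_le h12 h12 (hA b') (hJ b) (hH e) ψ
  have t3 := norm_expect_triple_le hκ0 h12 (hH e) (hJ b) (hA b') ψ
  have t4 := norm_expect_triple_le h12 hκ0 (hJ b) (hH e) (hA b') ψ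
  unfold dcOp
  rw [Matrix.add_mulVec, Matrix.sub_mulVec, Matrix.sub_mulVec, dotProduct_add, dotProduct_sub, dotProduct_sub]
  calc _ ≤ ‖star ψ ⬝ᵥ ((bondOp L b')ᴴ * (bondH L Δ e * bondOp L b)) *ᵥ ψ
            - star ψ ⬝ᵥ ((bondOp L b')ᴴ * (bondOp L b * bondH L Δ e)) *ᵥ ψ
            - star ψ ⬝ᵥ (bondH L Δ e * (bondOp L b * (bondOp L b')ᴴ)) *ᵥ ψ‖
          + ‖star ψ ⬝ᵥ (bondOp L b * (bondH L Δ e * (bondOp L b')ᴴ)) *ᵥ ψ‖ := norm_add_le _ _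
    _ ≤ ‖star ψ ⬝ᵥ ((bondOp L b')ᴴ * (bondH L Δ e * bondOp L b)) *ᵥ ψ
            - star ψ ⬝ᵥ ((bondOp L b')ᴴ * (bondOp L b * bondH L Δ e)) *ᵥ ψ‖
          + ‖star ψ ⬝ᵥ (bondH L Δ e * (bondOp L b * (bondOp L b')ᴴ)) *ᵥ ψ‖
          + ‖star ψ ⬝ᵥ (bondOp L b * (bondH L Δ e * (bondOp L b')ᴴ)) *ᵥ ψ‖ := by
        have := norm_sub_le (star ψ ⬝ᵥ ((bondOp L b')ᴴ * (bondH L Δ e * bondOp L b)) *ᵥ ψ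
            - star ψ ⬝ᵥ ((bondOp L b')ᴴ * (bondOp L b * bondH L Δ e)) *ᵥ ψ)
          (star ψ ⬝ᵥ (bondH L Δ e * (bondOp L b * (bondOp L b')ᴴ)) *ᵥ ψ)
        linarith
    _ ≤ ‖star ψ ⬝ᵥ ((bondOp L b')ᴴ * (bondH L Δ e * bondOp L b)) *ᵥ ψ‖
          + ‖star ψ ⬝ᵥ ((bondOp L b')ᴴ * (bondOp L b * bondH L Δ e)) *ᵥ ψ‖
          + ‖star ψ ⬝ᵥ (bondH L Δ e * (bondOp L b * (bondOp L b')ᴴ)) *ᵥ ψ‖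
          + ‖star ψ ⬝ᵥ (bondOp L b * (bondH L Δ e * (bondOp L b')ᴴ)) *ᵥ ψ‖ := by
        have := norm_sub_le (star ψ ⬝ᵥ ((bondOp L b')ᴴ * (bondH L Δ e * bondOp L b)) *ᵥ ψ)
          (star ψ ⬝ᵥ ((bondOp L b')ᴴ * (bondOp L b * bondH L Δ e)) *ᵥ ψ)
        linarith
    _ ≤ 1 / 2 * κ * (1 / 2) * ‖WithLp.toLp 2 ψ‖ ^ 2 + 1 / 2 * (1 / 2) * κ * ‖WithLp.toLp 2 ψ‖ ^ 2
          + κ * (1 / 2) * (1 / 2) * ‖WithLp.toLp 2 ψ‖ ^ 2 + 1 / 2 * κ * (1 / 2) * ‖WithLp.toLp 2 ψ‖ ^ 2 := by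
        linarith [t1, t2, t3, t4]
    _ = κ * ‖WithLp.toLp 2 ψ‖ ^ 2 := by ring

/-! ## Trilinear expansion of `[Wᴴ,[H,W]]` -/

/-- `(Σ aᵢAᵢ)((Σ bⱼBⱼ)(Σ cₖCₖ)) = Σᵢⱼₖ aᵢbⱼcₖ · Aᵢ(BⱼCₖ)`. -/
theorem triple_mul_expand {ι κ μ : Type*} [Fintype ι] [Fintype κ] [Fintype μ] {n : Type*} [Fintype n]
    [DecidableEq n] (a : ι → ℂ) (A : ι → Matrix n n ℂ) (b : κ → ℂ) (B : κ → Matrix n n ℂ)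
    (c : μ → ℂ) (C : μ → Matrix n n ℂ) :
    (∑ i, a i • A i) * ((∑ j, b j • B j) * (∑ k, c k • C k))
      = ∑ i, ∑ j, ∑ k, (a i * b j * c k) • (A i * (B j * C k)) := by
  simp only [Finset.sum_mul, Finset.mul_sum, smul_mul_assoc, mul_smul_comm, smul_smul, Finset.smul_sum]
  calc ∑ k, ∑ j, ∑ i, (c k * b j * a i) • (A i * (B j * C k))
      = ∑ k, ∑ i, ∑ j, (c k * b j * a i) • (A i * (B j * C k)) :=
        Finset.sum_congr rfl fun k _ => Finset.sum_comm
    _ = ∑ i, ∑ k, ∑ j, (c k * b j * a i) • (A i * (B j * C k)) := Finset.sum_comm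
    _ = ∑ i, ∑ j, ∑ k, (c k * b j * a i) • (A i * (B j * C k)) :=
        Finset.sum_congr rfl fun i _ => Finset.sum_comm
    _ = _ := by
        refine Finset.sum_congr rfl fun i _ => Finset.sum_congr rfl fun j _ =>
          Finset.sum_congr rfl fun k _ => ?_
        congr 1
        ring

/-- The bond coefficient `c_{(x,i)} = εᵢ φ_k(x)` of `W_k(ε)`. -/
def bondCoef (L : ℕ) [NeZero L] (k : TorusSite 2 L) (ε : Fin 2 → ℂ) (b : TorusSite 2 L × Fin 2) : ℂ :=
  ε b.2 * torusPhase L k b.1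

/-- `W_k(ε) = Σ_b c_b j_b`. -/
theorem currentComb_eq_sum_bondOp (k : TorusSite 2 L) (ε : Fin 2 → ℂ) :
    currentComb L k ε = ∑ b : TorusSite 2 L × Fin 2, bondCoef L k ε b • bondOp L b := by
  unfold currentComb currentMode bondCoef bondOp
  rw [Fintype.sum_prod_type_right]
  refine Finset.sum_congr rfl fun i _ => ?_
  rw [Finset.smul_sum]
  refine Finset.sum_congr rfl fun x _ => ?_
  rw [smul_smul]

/-- `W_k(ε)ᴴ = Σ_b conj(c_b) j_bᴴ`. -/
theorem currentComb_conjTranspose_eq (k : TorusSite 2 L) (ε : Fin 2 → ℂ) :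
    (currentComb L k ε)ᴴ = ∑ b : TorusSite 2 L × Fin 2, starRingEnd ℂ (bondCoef L k ε b) • (bondOp L b)ᴴ := by
  rw [currentComb_eq_sum_bondOp, Matrix.conjTranspose_sum]
  refine Finset.sum_congr rfl fun b _ => ?_
  rw [Matrix.conjTranspose_smul]
  rfl

/-- `H = Σ_e (−1)·h_e` (`L ≥ 3`). -/
theorem hcbHamiltonian_eq_sum_bondH (hL : 3 ≤ L) (Δ : ℝ) :
    hcbHamiltonian L Δ = ∑ e : TorusSite 2 L × Fin 2, (-1 : ℂ) • bondH L Δ e := by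
  rw [hcbHamiltonian_eq_neg_sum_xxzBond hL, ← Finset.sum_neg_distrib]
  refine Finset.sum_congr rfl fun e _ => ?_
  rw [neg_one_smul]
  rfl

/-- **`[Wᴴ,[H,W]] = Σ_{b',e,b} (−conj(c_{b'}) c_b)·dcOp b' e b`** in the association of `DoubleCommutatorBound` (`L ≥ 3`). -/
theorem doubleComm_expand (hL : 3 ≤ L) (Δ : ℝ) (k : TorusSite 2 L) (ε : Fin 2 → ℂ) :
    (currentComb L k ε)ᴴ * (hcbHamiltonian L Δ * currentComb L k ε)
      - (currentComb L k ε)ᴴ * (currentComb L k ε * hcbHamiltonian L Δ)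
      - hcbHamiltonian L Δ * (currentComb L k ε * (currentComb L k ε)ᴴ)
      + currentComb L k ε * (hcbHamiltonian L Δ * (currentComb L k ε)ᴴ)
    = ∑ b' : TorusSite 2 L × Fin 2, ∑ e : TorusSite 2 L × Fin 2, ∑ b : TorusSite 2 L × Fin 2,
        (starRingEnd ℂ (bondCoef L k ε b') * (-1) * bondCoef L k ε b) • dcOp L Δ b' e b := by
  set a : TorusSite 2 L × Fin 2 → ℂ := fun b => starRingEnd ℂ (bondCoef L k ε b) with ha
  set c : TorusSite 2 L × Fin 2 → ℂ := bondCoef L k ε with hc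
  set A : TorusSite 2 L × Fin 2 → Op (TorusSite 2 L) 2 := fun b => (bondOp L b)ᴴ with hAdef
  set Hm : TorusSite 2 L × Fin 2 → Op (TorusSite 2 L) 2 := bondH L Δ with hHm
  set J : TorusSite 2 L × Fin 2 → Op (TorusSite 2 L) 2 := bondOp L with hJ
  have hW : currentComb L k ε = ∑ b, c b • J b := currentComb_eq_sum_bondOp k ε
  have hWH : (currentComb L k ε)ᴴ = ∑ b, a b • A b := currentComb_conjTranspose_eq k ε
  have hH : hcbHamiltonian L Δ = ∑ e : TorusSite 2 L × Fin 2, (fun _ : TorusSite 2 L × Fin 2 => (-1 : ℂ)) e • Hm e :=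
    hcbHamiltonian_eq_sum_bondH hL Δ
  have h1 : (currentComb L k ε)ᴴ * (hcbHamiltonian L Δ * currentComb L k ε)
      = ∑ b', ∑ e, ∑ b, (a b' * (-1) * c b) • (A b' * (Hm e * J b)) := by
    rw [hWH, hH, hW, triple_mul_expand]
  have h2 : (currentComb L k ε)ᴴ * (currentComb L k ε * hcbHamiltonian L Δ)
      = ∑ b', ∑ e, ∑ b, (a b' * (-1) * c b) • (A b' * (J b * Hm e)) := by
    rw [hWH, hH, hW, triple_mul_expand]
    refine Finset.sum_congr rfl fun b' _ => ?_
    rw [Finset.sum_comm]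
    refine Finset.sum_congr rfl fun e _ => Finset.sum_congr rfl fun b _ => ?_
    congr 1
    ring
  have h3 : hcbHamiltonian L Δ * (currentComb L k ε * (currentComb L k ε)ᴴ)
      = ∑ b', ∑ e, ∑ b, (a b' * (-1) * c b) • (Hm e * (J b * A b')) := by
    rw [hWH, hH, hW, triple_mul_expand]
    calc ∑ e, ∑ b, ∑ b', ((-1) * c b * a b') • (Hm e * (J b * A b'))
        = ∑ e, ∑ b', ∑ b, ((-1) * c b * a b') • (Hm e * (J b * A b')) :=
          Finset.sum_congr rfl fun e _ => Finset.sum_comm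
      _ = ∑ b', ∑ e, ∑ b, ((-1) * c b * a b') • (Hm e * (J b * A b')) := Finset.sum_comm
      _ = _ := by
          refine Finset.sum_congr rfl fun b' _ => Finset.sum_congr rfl fun e _ =>
            Finset.sum_congr rfl fun b _ => ?_
          congr 1
          ring
  have h4 : currentComb L k ε * (hcbHamiltonian L Δ * (currentComb L k ε)ᴴ)
      = ∑ b', ∑ e, ∑ b, (a b' * (-1) * c b) • (J b * (Hm e * A b')) := by
    rw [hWH, hH, hW, triple_mul_expand]
    calc ∑ b, ∑ e, ∑ b', (c b * (-1) * a b') • (J b * (Hm e * A b'))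
        = ∑ e, ∑ b, ∑ b', (c b * (-1) * a b') • (J b * (Hm e * A b')) := Finset.sum_comm
      _ = ∑ e, ∑ b', ∑ b, (c b * (-1) * a b') • (J b * (Hm e * A b')) :=
          Finset.sum_congr rfl fun e _ => Finset.sum_comm
      _ = ∑ b', ∑ e, ∑ b, (c b * (-1) * a b') • (J b * (Hm e * A b')) := Finset.sum_comm
      _ = _ := by
          refine Finset.sum_congr rfl fun b' _ => Finset.sum_congr rfl fun e _ =>
            Finset.sum_congr rfl fun b _ => ?_
          congr 1
          ring
  rw [h1, h2, h3, h4]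
  simp only [← Finset.sum_sub_distrib, ← Finset.sum_add_distrib, ← smul_sub, ← smul_add]
  rfl

/-- The expectation functional `X ↦ ⟨ψ, Xψ⟩` through a triple sum of scalar multiples. -/
theorem expect_triple_sum_smul {ι : Type*} [Fintype ι] (ψ : TensorIndex (TorusSite 2 L) 2 → ℂ)
    (f : ι → ι → ι → ℂ) (X : ι → ι → ι → Op (TorusSite 2 L) 2) :
    star ψ ⬝ᵥ ((∑ i, ∑ j, ∑ l, f i j l • X i j l) *ᵥ ψ)
      = ∑ i, ∑ j, ∑ l, f i j l * (star ψ ⬝ᵥ (X i j l *ᵥ ψ)) := by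
  rw [Matrix.sum_mulVec, dotProduct_sum]
  refine Finset.sum_congr rfl fun i _ => ?_
  rw [Matrix.sum_mulVec, dotProduct_sum]
  refine Finset.sum_congr rfl fun j _ => ?_
  rw [sum_smul_mulVec, dotProduct_sum]
  refine Finset.sum_congr rfl fun l _ => ?_
  rw [dotProduct_smul, smul_eq_mul]

/-! ## STUB K1′ PROVED -/

/-- `Σ_b |c_b|² = L²·Σᵢ|εᵢ|²` (`|φ_k(x)| = 1`). -/
theorem sum_norm_bondCoef_sq (k : TorusSite 2 L) (ε : Fin 2 → ℂ) :
    ∑ b : TorusSite 2 L × Fin 2, ‖bondCoef L k ε b‖ ^ 2 = (L : ℝ) ^ 2 * ∑ j, ‖ε j‖ ^ 2 := by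
  unfold bondCoef
  simp only [norm_mul, norm_torusPhase, mul_one]
  rw [Fintype.sum_prod_type]
  simp only [Finset.sum_const, Finset.card_univ, nsmul_eq_mul]
  have hcard : Fintype.card (TorusSite 2 L) = L ^ 2 := by
    simp [TorusSite, ZMod.card, Fintype.card_fin]
  rw [hcard]
  push_cast
  ring

/-- **STUB K1′ PROVED — `DoubleCommutatorBound Δ M`** with `C_J = 128(1/2 + |Δ|/4) + 1`, for every `Δ` and every
magnetisation sequence `M` (pure support counting; valid from `L ≥ 3`). -/
theorem doubleCommutatorBound_holds (Δ : ℝ) (M : ℕ → ℝ) : DoubleCommutatorBound Δ M := by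
  set κ : ℝ := 1 / 2 + |Δ| / 4 with hκ
  have hκ0 : 0 ≤ κ := by positivity
  refine ⟨128 * κ + 1, by positivity, ?_⟩
  filter_upwards [Filter.eventually_ge_atTop 3] with L hL
  intro _ a ha k ε
  have hψ : ‖WithLp.toLp 2 (toC L a)‖ = 1 := norm_toC_eq_one L ha
  rw [doubleComm_expand hL, expect_triple_sum_smul]
  set T : (TorusSite 2 L × Fin 2) → (TorusSite 2 L × Fin 2) → (TorusSite 2 L × Fin 2) → ℂ :=
    fun b' e b => -(star (toC L a) ⬝ᵥ (dcOp L Δ b' e b *ᵥ toC L a)) with hTdef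
  have hT : ∀ b' e b, ‖T b' e b‖ ≤ κ := by
    intro b' e b
    rw [hTdef, norm_neg]
    have h := norm_expect_dcOp_le (by omega) Δ b' e b (toC L a)
    rw [hψ, one_pow, mul_one] at h
    exact h
  have hT0 : ∀ b' e b, ¬ BondRel L b' e b → T b' e b = 0 := by
    intro b' e b h
    rw [hTdef]
    simp only [dcOp_eq_zero_of_not_rel Δ h, Matrix.zero_mulVec, dotProduct_zero, neg_zero]
  have key := norm_triple_sum_le (bondCoef L k ε) T hκ0 hT hT0
  have hrw : ∑ b', ∑ e, ∑ b, starRingEnd ℂ (bondCoef L k ε b') * (-1) * bondCoef L k ε b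
        * (star (toC L a) ⬝ᵥ (dcOp L Δ b' e b *ᵥ toC L a))
      = ∑ b', ∑ e, ∑ b, starRingEnd ℂ (bondCoef L k ε b') * bondCoef L k ε b * T b' e b := by
    refine Finset.sum_congr rfl fun b' _ => Finset.sum_congr rfl fun e _ => Finset.sum_congr rfl fun b _ => ?_
    rw [hTdef]
    ring
  rw [hrw]
  have hre := Complex.re_le_norm (∑ b', ∑ e, ∑ b, starRingEnd ℂ (bondCoef L k ε b') * bondCoef L k ε b * T b' e b)
  rw [sum_norm_bondCoef_sq] at key
  have hpos : 0 ≤ (L : ℝ) ^ 2 * ∑ j, ‖ε j‖ ^ 2 := by positivity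
  nlinarith

end Summit.HubbardSuperconductivity.HubbardSuperconductivity.Theorems.AnisotropyChord.Stiffness
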